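import Summits.QuantumAdvantage.QuantumAdvantage.Theorems.CharDialLevelDialC
import HarnessLib

/-!
# CharDialTableDialA — TREE PART A of the decomp-qadv lens-5 g30 node «TableDial» on `CharDial.FrobStructureLawOdd`
# (stmt-QuantumAdvantage-27205): the pieces `TabLaw/TabAt/TabOdd` (table law: finite, level-free), `SeedLevel/SeedAt/SeedOdd` (seed),
# `FewAt/FewOdd` (rung), the slice/pair lemmas, `block_of_two_slices`, and the two KERNEL asymptotic regimes from the table core alone:
# `tabLaw_all_of_core` (every co-size) and `rPrime_succ_of_core` / `tail_of_core` (every level).  Verbatim from the node file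
# (namespace `Theses.TableDial → Theorems.TableDial`), cut at `end Levels` (≤ 400-line lint).

# TableDial — decomp-qadv lens-5 g30 node on `CharDial.FrobStructureLawOdd` (stmt-QuantumAdvantage-27205)

Lens 5 «finite/base range + asymptotic regime + bridge», applied INSIDE piece B (`LevelDial.BaseOdd`, the finite range of g29) of
piece E (`IslandDial.ExchCoreOdd`) of the g28 split.  g29 located the residual of E at `p = 7` as the single finite level
`RPrimeAt 7 4 16` — a statement about all Boolean functions of 16 variables, which the census (K41/K42) showed is NOT certifiable
by enumeration.  This node splits that base EXACTLY into a TABLE LAW (finite, level-free, CERTIFIED at `p = 7` by the census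
that already exists) and a SEED (a Ramsey-type statement, strictly weaker than B), with kernel bridges uniform in `(p, K)`.

THE DIAL.  For a class member `f` (depends on the `m`-set `X`, `𝔽_p`-degree `≤ p − 1`, constant non-zero top layer on `X`) that
is exchangeable on a block `R ⊆ X`, the dial is the CO-SIZE `L = |X| − |R|` of the block (the junta size of the table
presentation `f = G(u|_{X∖R}, wt_R mod p)`, tree `IslandDial.exch_weight_form`).
* FINITE RANGE = the TABLE CORE `TabLaw p K (2K+1)`: a class member exchangeable on a block `R` with `|R| ≥ p − 1` and co-size
  `≤ 2K + 1` is exchangeable off `≤ K` coordinates.  LEVEL-FREE: for `|R| ≥ p − 1` the block enters only through `wt_R mod p`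
  (all residues realised, `e_k(u_R)` genuine for `k ≤ p − 1`), so this is a statement about the finitely many tables
  `G : {0,1}^{≤ 2K+1} × 𝔽_p → {0,1}` — EXACTLY the «collapsed model» the census enumerated (K41 A3: `p = 7`, junta `m ≤ 9 = 2·4+1`,
  every table a twist pattern on `≤ 4` coordinates; `p = 5`: junta `≤ 7 ⊇ ≤ 3`, max twist 1).  So `TabLaw 7 4 9` and `TabLaw 5 1 3`
  are CERTIFIED (instrument), where g29's `RPrimeAt 7 4 16` was not certifiable at all.
* ASYMPTOTIC REGIME, two directions, both KERNEL from the core alone: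
  (i) every co-size: `tabLaw_all_of_core : TabLaw p K (2K+1) → ∀ L, TabLaw p K L` (induction on `L`: slice a junta coordinate, the
      two slices are tables of co-size `L`, their exchangeable sets meet in a block of co-size `≤ 2K+1` on which `f` itself is
      exchangeable (`block_of_two_slices`), and the core applies) — at `p = 7` this certifies the WHOLE collapsed model (every junta size),
      which the census could only observe as «stable for m ≤ 9»;
  (ii) every level: `rPrime_succ_of_core : TabLaw p K (2K+1) → 2K + (p−1) ≤ m → RPrimeAt p K m → RPrimeAt p K (m+1)` — the same
      two-slice argument; NO weight form, NO up-lemma: the table law is level-free, so g29's base level disappears.  (Without the core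
      the defect can at most double per level: `rPrime_succ_double : RPrimeAt p K m → RPrimeAt p (2K+1) (m+1)`.)
* BRIDGE bites from a SEED: `SeedAt p` — for every `m₀` there is a level `m ≥ m₀` at which every class member has `p − 1` pairwise
  exchangeable coordinates.  `baseAt_of_seed_tab : SeedAt p → TabAt p → BaseAt p` (seed level ⟹ `RPrimeAt p K m` by the table law at
  co-size `m − (p−1)` ⟹ all higher levels by (ii) ⟹ `BaseAt`).  The seed is typed «infinitely often» so that no budget is shared
  between the pieces (the critic's pairing remark on g29, CRITIC-LEDGER 74v28, does not arise).
* HOW FAR THE FINITE RANGE MUST REACH: co-size `2K₀(p) + 1` (= 3 at `p = 5`, = 9 at `p = 7` — exactly where census K41 A3 stopped).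

PIECES (BY NAME against the tree): `closes : SeedOdd → TabOdd → LevelDial.GlueOdd → IslandDial.IslandOdd → CharDial.FrobStructureLawOdd`,
EXACT: `target_iff_pieces : FrobStructureLawOdd ↔ SeedOdd ∧ TabOdd ∧ GlueOdd ∧ IslandOdd` and `exchCoreAt_iff_pieces :
ExchCoreAt p ↔ SeedAt p ∧ TabAt p ∧ GlueAt p`.  Necessity of every piece is via `ExchCoreAt` (trivial); `seedAt_of_baseAt` shows the
seed is implied by B alone.  ATTACK RUNG on the seed: `FewAt p` (a class member has at most `a(p)` pairwise NON-exchangeable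
coordinates, i.e. boundedly many exchangeability classes) gives the seed by PAIR RAMSEY (`seedAt_of_fewAt`, tree `SubChar.ramsey`),
and is itself necessary (`fewAt_of_exchCoreAt`).  LOCATED RESIDUAL of E at `p = 7`: the seed alone —
`baseAt_seven_of_core_seed : TabLaw 7 4 9 → 14 ≤ m → SeedLevel 7 m → BaseAt 7`.

No `sorry`, no new axioms, no instances, no notation; imports only the tree (`Theorems.CharDialLevelDialC`) and `HarnessLib`.
-/

set_option autoImplicit false
set_option linter.dupNamespace false

namespace Summit.QuantumAdvantage.QuantumAdvantage.Theorems.TableDial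

open Finset
open Summit.QuantumAdvantage.AdviceFreeQNC0
open Literature.Computability.MetaComplexity Literature.Computability.MetaComplexity.Smolensky
open Summit.QuantumAdvantage.QuantumAdvantage.Theorems.IslandDial (Exch TopConst ExchCoreAt ExchCoreOdd IslandAt IslandOdd)
open Summit.QuantumAdvantage.QuantumAdvantage.Theorems.LevelDial (RPrimeAt nB BaseAt BaseOdd TailAt GlueAt GlueOdd
  depOn_slice hasDegF_slice topConst_slice exch_mono exch_of_two_slices tail_of_base)

/-! ### §1 The pieces -/

/-- **TABLE LAW** at prime `p`, twist budget `K`, co-size budget `L`: a class member on `X` (depends on `X`, `𝔽_p`-degree `≤ p − 1`,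
constant non-zero top layer on `X`) that is ALREADY exchangeable on a block `R ⊆ X` with `|R| ≥ p − 1` and `|X| ≤ |R| + L` is
exchangeable on some `Y ⊆ X` with `|X ∖ Y| ≤ K`.  For `|R| ≥ p − 1` this is a statement about tables `{0,1}^{X∖R} × 𝔽_p → {0,1}`
(the collapsed model of census K41 A3); the instance `L = 2K + 1` is the TABLE CORE. -/
def TabLaw (p : ℕ) [Fact p.Prime] (K L : ℕ) : Prop :=
  ∀ (n : ℕ) (f : (Fin n → Bool) → Bool) (X R : Finset (Fin n)), R ⊆ X → p - 1 ≤ R.card → X.card ≤ R.card + L →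
    DependsOn f (↑X : Set (Fin n)) → HasDegF p f (p - 1) → (∃ γ : ZMod p, γ ≠ 0 ∧ TopConst p f X γ) → Exch f R →
    ∃ Y : Finset (Fin n), Y ⊆ X ∧ X.card ≤ Y.card + K ∧ Exch f Y

/-- FINITE RANGE at `p`: the table core holds for some twist budget `K`. -/
def TabAt (p : ℕ) [Fact p.Prime] : Prop := ∃ K : ℕ, TabLaw p K (2 * K + 1)

/-- Piece «Tab», typed over the odd primes `p ≥ 5` of the target. -/
def TabOdd : Prop := ∀ (p : ℕ) [Fact p.Prime], 5 ≤ p → TabAt p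

/-- **SEED at level `m`**: every class member at level `m` has `p − 1` pairwise exchangeable coordinates inside `X`. -/
def SeedLevel (p : ℕ) [Fact p.Prime] (m : ℕ) : Prop :=
  ∀ (n : ℕ) (f : (Fin n → Bool) → Bool) (X : Finset (Fin n)), X.card = m → DependsOn f (↑X : Set (Fin n)) →
    HasDegF p f (p - 1) → (∃ γ : ZMod p, γ ≠ 0 ∧ TopConst p f X γ) →
    ∃ R : Finset (Fin n), R ⊆ X ∧ p - 1 ≤ R.card ∧ Exch f R

/-- SEED at `p` («infinitely often» form — no budget is shared with the table law): beyond every `m₀` some level carries the seed. -/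
def SeedAt (p : ℕ) [Fact p.Prime] : Prop := ∀ m₀ : ℕ, ∃ m : ℕ, m₀ ≤ m ∧ SeedLevel p m

/-- Piece «Seed», typed over the odd primes `p ≥ 5` of the target. -/
def SeedOdd : Prop := ∀ (p : ℕ) [Fact p.Prime], 5 ≤ p → SeedAt p

/-- ATTACK RUNG for the seed: at most `a` pairwise NON-exchangeable coordinates (= boundedly many exchangeability classes on `X`). -/
def FewAt (p : ℕ) [Fact p.Prime] : Prop :=
  ∃ a : ℕ, ∀ (n : ℕ) (f : (Fin n → Bool) → Bool) (X : Finset (Fin n)), DependsOn f (↑X : Set (Fin n)) →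
    HasDegF p f (p - 1) → (∃ γ : ZMod p, γ ≠ 0 ∧ TopConst p f X γ) →
    ∀ A : Finset (Fin n), A ⊆ X → (∀ i ∈ A, ∀ j ∈ A, i ≠ j → ¬ (∀ u : Fin n → Bool, f (u ∘ Equiv.swap i j) = f u)) → A.card ≤ a

/-- The rung over the odd primes. -/
def FewOdd : Prop := ∀ (p : ℕ) [Fact p.Prime], 5 ≤ p → FewAt p

/-! ### §2 Monotonicity, slices, pairs -/

section Basic

variable {p : ℕ} [hp : Fact p.Prime] {n : ℕ}

/-- The table law is monotone in the co-size budget (downwards). -/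
theorem tabLaw_mono_L {K L L' : ℕ} (h : TabLaw p K L') (hL : L ≤ L') : TabLaw p K L :=
  fun n f X R hRX hRp hXc hdep hf hγ hexR => h n f X R hRX hRp (by omega) hdep hf hγ hexR

/-- The table law is monotone in the twist budget (upwards, at fixed co-size budget). -/
theorem tabLaw_mono_K {K K' L : ℕ} (h : TabLaw p K L) (hK : K ≤ K') : TabLaw p K' L := by
  intro n f X R hRX hRp hXc hdep hf hγ hexR
  obtain ⟨Y, hYX, hYc, hYex⟩ := h n f X R hRX hRp hXc hdep hf hγ hexR
  exact ⟨Y, hYX, by omega, hYex⟩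

/-- R′ is monotone in the budget. -/
theorem rPrimeAt_mono {K K' m : ℕ} (h : RPrimeAt p K m) (hK : K ≤ K') : RPrimeAt p K' m := by
  intro n f X hXc hdep hf hγ
  obtain ⟨Y, hYX, hYc, hYex⟩ := h n f X hXc hdep hf hγ
  exact ⟨Y, hYX, by omega, hYex⟩

/-- Exchangeability on `R ⊆ S` is inherited by every slice over `S`. -/
theorem exch_slice {f : (Fin n → Bool) → Bool} {R S : Finset (Fin n)} (h : Exch f R) (hRS : R ⊆ S) (v : Fin n → Bool) :
    Exch (fun u => f (SubLog.merge S u v)) R := by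
  intro i hi j hj u
  have key : SubLog.merge S (u ∘ Equiv.swap i j) v = SubLog.merge S u v ∘ Equiv.swap i j := by
    funext k
    show (if k ∈ S then u (Equiv.swap i j k) else v k) =
      (if Equiv.swap i j k ∈ S then u (Equiv.swap i j k) else v (Equiv.swap i j k))
    by_cases hki : k = i
    · rw [hki, Equiv.swap_apply_left, if_pos (hRS hi), if_pos (hRS hj)]
    · by_cases hkj : k = j
      · rw [hkj, Equiv.swap_apply_right, if_pos (hRS hj), if_pos (hRS hi)]
      · rw [Equiv.swap_apply_of_ne_of_ne hki hkj]
  show f (SubLog.merge S (u ∘ Equiv.swap i j) v) = f (SubLog.merge S u v)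
  rw [key]
  exact h i hi j hj _

/-- One invariant transposition makes the pair exchangeable. -/
theorem exch_pair {f : (Fin n → Bool) → Bool} {i j : Fin n} (h : ∀ u : Fin n → Bool, f (u ∘ Equiv.swap i j) = f u) :
    Exch f ({i, j} : Finset (Fin n)) := by
  intro a ha b hb u
  simp only [Finset.mem_insert, Finset.mem_singleton] at ha hb
  rcases ha with rfl | rfl <;> rcases hb with rfl | rfl
  · exact SubChar.swapInv_self f _ u
  · exact h u
  · exact SubChar.swapInv_symm f h u
  · exact SubChar.swapInv_self f _ u

/-- **TWO-SLICE LEMMA.**  If both `x`-slices of `f` (`x ∈ X`, `f` a function of `X`) are exchangeable off `≤ K` coordinates of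
`X ∖ x`, then `f` itself is exchangeable on a block of co-size `≤ 2K + 1` in `X`. -/
theorem block_of_two_slices {f : (Fin n → Bool) → Bool} {X : Finset (Fin n)} {x : Fin n} {K : ℕ} (hx : x ∈ X)
    (hdep : DependsOn f (↑X : Set (Fin n)))
    (h : ∀ b : Bool, ∃ Y : Finset (Fin n), Y ⊆ X.erase x ∧ (X.erase x).card ≤ Y.card + K ∧
      Exch (fun u => f (SubLog.merge (X.erase x) u (fun _ => b))) Y) :
    ∃ R : Finset (Fin n), R ⊆ X.erase x ∧ X.card ≤ R.card + (2 * K + 1) ∧ Exch f R := by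
  classical
  obtain ⟨Y0, hY0sub, hY0c, hY0ex⟩ := h false
  obtain ⟨Y1, hY1sub, hY1c, hY1ex⟩ := h true
  refine ⟨Y0 ∩ Y1, Finset.inter_subset_left.trans hY0sub, ?_, ?_⟩
  · have h1 : (Y0 ∪ Y1).card + (Y0 ∩ Y1).card = Y0.card + Y1.card := Finset.card_union_add_card_inter Y0 Y1
    have h2 : (Y0 ∪ Y1).card ≤ (X.erase x).card := Finset.card_le_card (Finset.union_subset hY0sub hY1sub)
    have h3 : (X.erase x).card + 1 = X.card := Finset.card_erase_add_one hx
    omega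
  · exact exch_of_two_slices hdep (Finset.inter_subset_left.trans hY0sub) fun b => by
      cases b
      · exact exch_mono hY0ex Finset.inter_subset_left
      · exact exch_mono hY1ex Finset.inter_subset_right

end Basic

/-! ### §3 Asymptotic regime (i): the core gives every co-size -/

section CoSize

variable {p : ℕ} [hp : Fact p.Prime]

/-- One co-size up from the core and the previous co-size. -/
theorem tabLaw_succ {K L : ℕ} (hcore : TabLaw p K (2 * K + 1)) (hL : 2 * K + 1 ≤ L) (ih : TabLaw p K L) :
    TabLaw p K (L + 1) := by
  classical
  intro n f X R hRX hRp hXc hdep hf hγ hexR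
  by_cases hle : X.card ≤ R.card + L
  · exact ih n f X R hRX hRp hle hdep hf hγ hexR
  -- a junta coordinate `x ∈ X ∖ R` to slice along
  obtain ⟨x, hx⟩ : (X \ R).Nonempty := by
    rw [← Finset.card_pos]
    have h1 : (X \ R).card + R.card = X.card := Finset.card_sdiff_add_card_eq_card hRX
    omega
  have hxX : x ∈ X := (Finset.mem_sdiff.1 hx).1
  have hxR : x ∉ R := (Finset.mem_sdiff.1 hx).2
  have hRX₁ : R ⊆ X.erase x := fun r hr => Finset.mem_erase.2 ⟨fun e => hxR (e ▸ hr), hRX hr⟩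
  have hX₁c : (X.erase x).card + 1 = X.card := Finset.card_erase_add_one hxX
  obtain ⟨γ, hγ0, htop⟩ := hγ
  -- both slices are tables of co-size `L` over the same block `R`
  have hsl : ∀ b : Bool, ∃ Y : Finset (Fin n), Y ⊆ X.erase x ∧ (X.erase x).card ≤ Y.card + K ∧
      Exch (fun u => f (SubLog.merge (X.erase x) u (fun _ => b))) Y := fun b =>
    ih n _ (X.erase x) R hRX₁ hRp (by omega) (depOn_slice f (X.erase x) _) (hasDegF_slice hf (X.erase x) _)
      ⟨γ, hγ0, topConst_slice hf htop (subset_refl _) (Finset.erase_subset x X) _⟩ (exch_slice hexR hRX₁ _)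
  -- `f` is exchangeable on a block of co-size `≤ 2K + 1`: the core applies
  obtain ⟨S, hSsub, hSc, hSex⟩ := block_of_two_slices hxX hdep hsl
  exact hcore n f X S (hSsub.trans (Finset.erase_subset x X)) (by omega) hSc hdep hf ⟨γ, hγ0, htop⟩ hSex

/-- **THE CORE GIVES EVERY CO-SIZE (kernel, uniform in `p, K`).**  At `p = 7`, `K = 4` the hypothesis is the census-certified
collapsed model with junta `≤ 9`; the conclusion is the collapsed model at every junta size. -/
theorem tabLaw_all_of_core {K : ℕ} (hcore : TabLaw p K (2 * K + 1)) : ∀ L : ℕ, TabLaw p K L := by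
  intro L
  induction L with
  | zero => exact tabLaw_mono_L hcore (Nat.zero_le _)
  | succ L ih =>
    by_cases hL : 2 * K + 1 ≤ L
    · exact tabLaw_succ hcore hL ih
    · exact tabLaw_mono_L hcore (by omega)

/-- `TabAt p` read with every co-size. -/
theorem tabAt_iff_all (p : ℕ) [Fact p.Prime] : TabAt p ↔ ∃ K : ℕ, ∀ L : ℕ, TabLaw p K L :=
  ⟨fun ⟨K, hK⟩ => ⟨K, tabLaw_all_of_core hK⟩, fun ⟨K, hK⟩ => ⟨K, hK _⟩⟩

end CoSize

/-! ### §4 Asymptotic regime (ii): the core carries R′ from any level `≥ 2K + (p − 1)` to all higher levels -/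

section Levels

variable {p : ℕ} [hp : Fact p.Prime]

/-- Without any base the defect at most doubles per level (two slices). -/
theorem rPrime_succ_double {K m : ℕ} (ih : RPrimeAt p K m) : RPrimeAt p (2 * K + 1) (m + 1) := by
  classical
  intro n f X hXc hdep hf hγ
  obtain ⟨γ, hγ0, htop⟩ := hγ
  obtain ⟨x, hx⟩ : X.Nonempty := Finset.card_pos.1 (by omega)
  have hX₁c : (X.erase x).card + 1 = X.card := Finset.card_erase_add_one hx
  have hsl : ∀ b : Bool, ∃ Y : Finset (Fin n), Y ⊆ X.erase x ∧ (X.erase x).card ≤ Y.card + K ∧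
      Exch (fun u => f (SubLog.merge (X.erase x) u (fun _ => b))) Y := fun b => by
    obtain ⟨Y, hY, hc, hex⟩ := ih n _ (X.erase x) (by omega) (depOn_slice f (X.erase x) _)
      (hasDegF_slice hf (X.erase x) _) ⟨γ, hγ0, topConst_slice hf htop (subset_refl _) (Finset.erase_subset x X) _⟩
    exact ⟨Y, hY, by omega, hex⟩
  obtain ⟨S, hSsub, hSc, hSex⟩ := block_of_two_slices hx hdep hsl
  exact ⟨S, hSsub.trans (Finset.erase_subset x X), by omega, hSex⟩

/-- **INDUCTION STEP from the table core.**  Level `m ≥ 2K + (p − 1)` gives level `m + 1`: the two slices are exchangeable off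
`≤ K`, so `f` is exchangeable on a block of co-size `≤ 2K + 1` and size `≥ m − 2K ≥ p − 1`, and the core cuts the defect back to `K`.
No weight form, no up-lemma. -/
theorem rPrime_succ_of_core {K m : ℕ} (hcore : TabLaw p K (2 * K + 1)) (hm : 2 * K + (p - 1) ≤ m) (ih : RPrimeAt p K m) :
    RPrimeAt p K (m + 1) := by
  classical
  intro n f X hXc hdep hf hγ
  obtain ⟨γ, hγ0, htop⟩ := hγ
  obtain ⟨x, hx⟩ : X.Nonempty := Finset.card_pos.1 (by omega)
  have hX₁c : (X.erase x).card + 1 = X.card := Finset.card_erase_add_one hx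
  have hsl : ∀ b : Bool, ∃ Y : Finset (Fin n), Y ⊆ X.erase x ∧ (X.erase x).card ≤ Y.card + K ∧
      Exch (fun u => f (SubLog.merge (X.erase x) u (fun _ => b))) Y := fun b => by
    obtain ⟨Y, hY, hc, hex⟩ := ih n _ (X.erase x) (by omega) (depOn_slice f (X.erase x) _)
      (hasDegF_slice hf (X.erase x) _) ⟨γ, hγ0, topConst_slice hf htop (subset_refl _) (Finset.erase_subset x X) _⟩
    exact ⟨Y, hY, by omega, hex⟩
  obtain ⟨S, hSsub, hSc, hSex⟩ := block_of_two_slices hx hdep hsl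
  obtain ⟨Y, hYX, hYc, hYex⟩ :=
    hcore n f X S (hSsub.trans (Finset.erase_subset x X)) (by omega) hSc hdep hf ⟨γ, hγ0, htop⟩ hSex
  exact ⟨Y, hYX, by omega, hYex⟩

/-- **THE LEVEL BRIDGE (kernel, uniform in `p, K`).**  The core and R′ at one level `m₀ ≥ 2K + (p − 1)` give every level `≥ m₀`. -/
theorem tail_of_core {K m₀ : ℕ} (hcore : TabLaw p K (2 * K + 1)) (hm₀ : 2 * K + (p - 1) ≤ m₀) (h₀ : RPrimeAt p K m₀) :
    ∀ m : ℕ, m₀ ≤ m → RPrimeAt p K m := by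
  intro m hm
  induction m, hm using Nat.le_induction with
  | base => exact h₀
  | succ m hm ih => exact rPrime_succ_of_core hcore (by omega) ih

/-- In particular the table core can replace g29's base in `tail_of_base`: with the core, R′ at level `nB p K` is still a valid
starting point (`nB p K ≥ 2K + (p − 1)`). -/
theorem tail_of_core_nB {K : ℕ} (hcore : TabLaw p K (2 * K + 1)) (h₀ : RPrimeAt p K (nB p K)) :
    ∀ m : ℕ, nB p K ≤ m → RPrimeAt p K m := by
  have hnB : nB p K = 2 * K + 1 + max p (K + 1) := rfl
  exact tail_of_core hcore (by rw [hnB]; omega) h₀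

/-- R′ at every level beyond some `m₀` (with one budget) gives the finite range of g29. -/
theorem baseAt_of_levels {K m₀ : ℕ} (h : ∀ m : ℕ, m₀ ≤ m → RPrimeAt p K m) : BaseAt p := by
  refine ⟨max K m₀, ?_⟩
  have hnB : nB p (max K m₀) = 2 * max K m₀ + 1 + max p (max K m₀ + 1) := rfl
  have h1 : m₀ ≤ nB p (max K m₀) := by rw [hnB]; omega
  exact rPrimeAt_mono (h _ h1) (le_max_left _ _)

end Levels


end Summit.QuantumAdvantage.QuantumAdvantage.Theorems.TableDial
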